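import Summits.QuantumFields.BalabanUV.T4Continuum.Support.NE9SpeciesDataOfRecordAdmissible
import Summits.QuantumFields.BalabanUV.T4Continuum.Support.NE9EndAppliedRealRow

/-!
# NE9EndOfRecordSpecies — THE END OF RECORD (real row, p225379) APPLIED AT THE SPECIES DATA OF RECORD: the two species families
# `D U ∕ K U` of `NE9EndAppliedRealRow.termSize_ne9_and_fadingMemory_realRow` := `curDataOfRecord ∕ kerDataOfRecord` (generation 36)
# — the frame binders `hLa ∕ hLb ∕ hκ₁ ∕ hR ∕ hdY`, the letter `hO1` and the weight positivity `hwt` are GONE (discharged), the species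
# binders `hD ∕ hK` are REPLACED BY THEIR ANALYTIC CLAUSES; every other binder of the END is displayed VERBATIM at the data of record
# (cell `pub-balaban`, T4-DAG §2 node U3 ∕ §6 NE9; BINDER row NE9 OWNER lineage `b2b-balaban-t4-ne9-p1`, generation 36; WALL-NE9-P1 §3
# (vii) item (ii); nothing of any import modified)

HONEST FRAMING (T4-DAG PAGE 1).  Rung (B)+1 of the FINITE-VOLUME T⁴ programme — NOT infinite volume, NOT a mass gap, NOT the
Clay problem.  NE9 (`T4OutputRate.NE9` ∧ `FadingMemory`) is a cell NEW ESTIMATE, NOT PRINTED in [I] = [Balaban1987RG1]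
(CMP **109**), [II] = [Balaban1988RG2Cluster] (CMP **116**), and NOT PROVED for Bałaban's E^{(j)} («NE9 ⇐ the named binders»;
spine PROVED 0∕9).  HONEST DEPENDENCY (cell line, verbatim): continuum YM on T⁴ ⇐ BetaPertH ∧ nine spine estimates (0/9 proved);
BetaPertH ⇐ (D1) ∧ (D4) ∧ CAP+tail; G-an2-4 gates asym, D1 and NE2/3/4.  `FlowStep.BetaPertH`, (B), (B^μ) do not occur.  ONE
composition BY NAME; the activities `act U`, the classes `Adm ∕ MF`, the read-out `r`, the marginal direction `A`, the majorants `n`,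
the vacuum point, explicit part and scale-0 datum, and the species' ANALYTIC fields stay PARAMETERS with their binders DISPLAYED
(T-rows ∕ (R-1) ∕ S-rows of WALL-NE9-P1 §2 — ABSOLUTE RULE: nothing printed in the audited series is asserted); 0 sorry.

WHAT.  `SpeciesParams R Bg E ι Pt` packages the species' parameters of record (output reading `Yout`, `κ₁`, t_□-radii `rT`,
analyticity radii `Rad`, per-background slice curves `cur U` and slice radii `ϱ U`, points `pts ∕ p0 ∕ dX ∕ ρd ∕ m`, per-background bilocal
summand `ker U`); `𝔭.D U := curDataOfRecord …`, `𝔭.K U := kerDataOfRecord …`.  **`termSize_ne9_and_fadingMemory_ofRecordSpecies`**: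
the END of record's conclusion `TermSize ∧ NE9 ∧ FadingMemory` (letters LITERALLY the END's: `Λ = prodModuli ℓ (fun _ ↦ ω′)`,
`ℓ = 8·clipbar·B + 8·lipbar·B·qTbar`, `ω′ = ω + 8·lipbar·B·(1+cr·aA)·(cQa+cQb)`) for the real-row functional `EreOf G act (weights of
record) U₀ explZ base (channels of record) (margProj r A) pt`, from: the species' analytic clauses (`cur_an`, `ϱ`-letters; `KerZero`,
`kerBound`, (G)(S)) — HYPOTHESES in the tree's shapes —, the count letters (κ ≥ 144, κ − w ≥ 144, κ₁ ≥ 69, the two `625·(L⁴)^{k−j}·gain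
≤ c_Q·ω^{k−j}` inequalities), and the END's remaining binders verbatim (A1 `hKP`, A2 `hCup`, A3 `hlip ∕ hroom ∕ hkerL`, continuity
`hcont ∕ hkerC`, MF, S1∕S2 `hAdm ∕ hres`, RO `hrA ∕ hr0 ∕ hrs`, AW `hA`, MP `hPinto`, G1∕G2 `hdec ∕ hpin`, N1 letters, `hexplZ ∕ hbase0`).
DISCHARGED INSIDE: `hD ∕ hK` (`admissible_cur∕kerDataOfRecord`), `hLa ∕ hLb` (`levelCountsG_of_frameOfRecord_gain` ∕
`levelCountsG_kerDataOfRecord`), `hκ₁ ∕ hR ∕ hdY` (`rfl`), `hO1` (`norm_num`), `hwt` (**`weightOf_record_pos`**: the weights of record are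
positive from `0 < cdir`, `0 < r_k`, `cK, c0, c1 ≥ 0` — the rider «hwt ⇐ 0 < O1 ∧ 0 < cdir» of CARVER-NOTES g33 §3 folded).
DISGUISE TEST: a composition; the hypotheses ARE the END's at the data of record; not NE9 for Bałaban's E^{(j)} (O-NE9-1: `act U :=
actChart …` on the substrate's Slots of record, the species' analytic fields, `c ∕ w`, S-PROBE letters remain).

References (TYPES ∕ loci only): [Balaban1987RG1] T. Bałaban, CMP **109** (1987) 249–301, Thm 1 p. 259, (1.18) p. 263, (2.13)–(2.14)
p. 268, Lemma 4 (3.53) p. 280, (4.20)–(4.30) pp. 285–288; [Balaban1988RG2Cluster] T. Bałaban, CMP **116** (1988) 1–22, (1.23)–(1.29)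
pp. 7–8, (1.33)–(1.36) p. 9.  Summits-side NEW work (LEAN PLACEMENT RULE); imports `NE9SpeciesDataOfRecordAdmissible` (generation 36)
and `NE9EndAppliedRealRow` (p225379) BY NAME; modifies nothing.  Value = the row's END with every frame∕letter binder of the species
side closed at the data of record, NOT summit progress.
-/

noncomputable section

namespace Summit.QuantumFields.BalabanUV.T4Continuum.NE9EndOfRecordSpecies

open scoped BigOperators ENNReal
open Metric Set
open Literature.Probability.LatticeModels
open Literature.MathematicalPhysics.QuantumFieldTheory.Balaban1983to89
open Literature.MathematicalPhysics.QuantumFieldTheory.Balaban1983to89.T4OutputRate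
open Literature.MathematicalPhysics.QuantumFieldTheory.Balaban1983to89.T4HistoryLipschitzRecursion
open Literature.MathematicalPhysics.QuantumFieldTheory.Balaban1983to89.T4HistoryLipschitzOuter
open Literature.MathematicalPhysics.QuantumFieldTheory.Balaban1983to89.T4HistoryLipschitzActivity
open Literature.MathematicalPhysics.QuantumFieldTheory.Balaban1983to89.T4HistoryLipschitzActivity (ClusterGeom)
open Literature.MathematicalPhysics.QuantumFieldTheory.Balaban1983to89.T4HistoryLipschitzSegment
open Summit.QuantumFields.BalabanUV.T4Continuum.B13Carriers (TwoRuns)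
open Summit.QuantumFields.BalabanUV.T4Continuum.B13DomainGeometryTR
open Summit.QuantumFields.BalabanUV.T4Continuum.NE9Lemma1Counting
open Summit.QuantumFields.BalabanUV.T4Continuum.NE9Lemma1Gain
open Summit.QuantumFields.BalabanUV.T4Continuum.NE9Lemma1PieceClass
open Summit.QuantumFields.BalabanUV.T4Continuum.NE9Lemma1RemainderSpecies
open Summit.QuantumFields.BalabanUV.T4Continuum.NE9Lemma1CurveSpecies
open Summit.QuantumFields.BalabanUV.T4Continuum.NE9Lemma1KernelSpecies
open Summit.QuantumFields.BalabanUV.T4Continuum.NE9ComplexEncoding (doubleCarriers)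
open Summit.QuantumFields.BalabanUV.T4Continuum.NE9MarginalProjection
open Summit.QuantumFields.BalabanUV.T4Continuum.NE9MarginalProjectionEnd
open Summit.QuantumFields.BalabanUV.T4Continuum.NE9ChannelSum
open Summit.QuantumFields.BalabanUV.T4Continuum.NE9SizeFedCoupling
open Summit.QuantumFields.BalabanUV.T4Continuum.NE9TableReading
open Summit.QuantumFields.BalabanUV.T4Continuum.NE9RecursionFunctional
open Summit.QuantumFields.BalabanUV.T4Continuum.NE9EndApplied
open Summit.QuantumFields.BalabanUV.T4Continuum.NE9ChartFamilyPullback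
open Summit.QuantumFields.BalabanUV.T4Continuum.NE9EndAppliedRealRow
open Summit.QuantumFields.BalabanUV.T4Continuum.NE9SpeciesFrameOfRecord
open Summit.QuantumFields.BalabanUV.T4Continuum.NE9SpeciesDataOfRecord
open Summit.QuantumFields.BalabanUV.T4Continuum.NE9SpeciesDataOfRecordAdmissible

variable {G₀ : Type} [GaugeGroup G₀] {R : TwoRuns G₀} {Bg E ι Pt : Type}

/-! ## §1 The species parameters of record -/

variable (R Bg E ι Pt) in
/-- [folklore] DATA: **THE SPECIES PARAMETERS OF RECORD** — what the two species data of record (`curDataOfRecord`, `kerDataOfRecord`)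
leave as parameters: the output reading `Yout` (table coordinate ↦ output domain), `κ₁`, the t_□-radii `rT k` ([II] (1.22)), the
analyticity radii `Rad X` (the R_X of the END's class), PER BACKGROUND the slice curves `cur U` and slice radii `ϱ U` of species (a)
([I] Lemma 4), the points `pts`, base point `p0`, distances `dX ∕ ρd`, power `m` and PER BACKGROUND the bilocal summand `ker U` of
species (b) ([I] (4.20)–(4.30)). [cite: Balaban1987RG1, (3.53) p.280 and (4.20)-(4.22) pp.285-286; Balaban1988RG2Cluster, (1.22)-(1.23) p.7] -/
structure SpeciesParams where
  /-- the output domain of a table coordinate at step `k` -/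
  Yout : ℕ → ι → R.carriers.Dom
  /-- κ₁ -/
  κ₁ : ℝ
  /-- the t_□-radii r_k -/
  rT : ℕ → ℝ
  /-- the analyticity radii R_X -/
  Rad : R.carriers.Dom → ℝ
  /-- species (a): the slice curves, per background -/
  cur : Bg → ℕ → (ℕ → ℝ) → ι → SCube R → Finset (SCube R) → (doubleCarriers R.carriers).Dom → ℂ → (SCube R → ℝ) →
    (SCube R → ℂ) → ℂ → E
  /-- species (a): the slice radii, per background -/
  ϱ : Bg → ℕ → (ℕ → ℝ) → ι → SCube R → Finset (SCube R) → (doubleCarriers R.carriers).Dom → ℝ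
  /-- species (b): the points of □̃⁴ -/
  pts : ℕ → ι → SCube R → Finset Pt
  /-- species (b): the base point of a source -/
  p0 : R.carriers.Dom → Pt
  /-- species (b): dist^{(ξ)}(X, p) -/
  dX : R.carriers.Dom → Pt → ℝ
  /-- species (b): |p − q| -/
  ρd : Pt → Pt → ℝ
  /-- species (b): the power m -/
  m : ℕ
  /-- species (b): the bilocal summand, per background -/
  ker : Bg → ℕ → (ℕ → ℝ) → ι → SCube R → Finset (SCube R) → (doubleCarriers R.carriers).Dom → ℂ → (SCube R → ℝ) →
    (SCube R → ℂ) → Pt → Pt → (E → ℂ) → ℂ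

namespace SpeciesParams

variable (𝔭 : SpeciesParams R Bg E ι Pt)

/-- [folklore] The curve-species datum of record at the background `U`. -/
abbrev D (U : Bg) : CurData R.carriers E ι (SCube R) (Finset (SCube R)) (SCube R) (SCube R) :=
  curDataOfRecord R 𝔭.Yout 𝔭.κ₁ 𝔭.rT 𝔭.Rad (𝔭.cur U) (𝔭.ϱ U)

/-- [folklore] The kernel-species datum of record at the background `U`. -/
abbrev K (U : Bg) : KerData R.carriers E ι (SCube R) (Finset (SCube R)) (SCube R) (SCube R) Pt :=
  kerDataOfRecord R 𝔭.Yout 𝔭.κ₁ 𝔭.rT 𝔭.Rad 𝔭.pts 𝔭.p0 𝔭.dX 𝔭.ρd 𝔭.m (𝔭.ker U)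

/-- [folklore] **THE WEIGHTS OF RECORD ARE POSITIVE** (the END's `hwt`, i.e. the rider «`hwt` ⇐ `0 < O1 ∧ 0 < cdir`»): with
`Kp = 64·cdir⁵∕r_k + 2·cK·e^{w₀}·c₀·c₁∕r_k`, `O1 = 2·(2²⁰+1)`, the channel weight `Kp·O1·e·exp(⅛κ₁d₀)·exp(−(1/16)κ₁·dY)` is positive
for `0 < cdir`, `0 < r_k`, `cK, c₀, c₁ ≥ 0`. -/
theorem weightOf_record_pos {cdir cK w0 c0 c1 : ℝ} (hcdir : 0 < cdir) (hr : ∀ k, 0 < 𝔭.rT k) (hcK : 0 ≤ cK) (hc0 : 0 ≤ c0)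
    (hc1 : 0 ≤ c1) (U : Bg) (k : ℕ) (y : ι) :
    0 < weightOf (𝔭.D U).toC.frame (𝔭.D U).κ₁ 21203 (2 * (2 ^ 20 + 1)) ((𝔭.D U).Kp cdir + (𝔭.K U).Kp cK w0 c0 c1) k y := by
  have hrk := hr k
  show 0 < (64 * cdir ^ 5 / 𝔭.rT k + 2 * cK * Real.exp w0 * c0 * c1 / 𝔭.rT k) * (2 * (2 ^ 20 + 1)) * Real.exp 1 *
    Real.exp ((1 / 8) * 𝔭.κ₁ * 21203) * Real.exp (-(1 / 16) * 𝔭.κ₁ * (1 + R.carriers.d (𝔭.Yout k y)))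
  positivity

end SpeciesParams

/-! ## §2 The END of record at the species data of record -/

/-- **THE END OF RECORD AT THE SPECIES DATA OF RECORD.**  `NE9EndAppliedRealRow.termSize_ne9_and_fadingMemory_realRow` (p225379) with
`D U := 𝔭.D U` (`curDataOfRecord`), `K U := 𝔭.K U` (`kerDataOfRecord`), `d₀ := 21203`, `O1 := 2·(2²⁰+1)`: the frame binders
`hLa ∕ hLb` (level counts), `hκ₁ ∕ hR ∕ hdY`, `hO1`, `hwt` are DISCHARGED; `hD ∕ hK` are REPLACED by the species' analytic clauses (HYPOTHESES,
in the tree's shapes: `cur_an` = [I] Lemma 4 (3.53); `KerZero`, `kerBound` = [I] (4.21)–(4.22); (G)∕(S); radii letters); the count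
letters `144 ≤ κ`, `144 ≤ κ − w`, `69 ≤ κ₁`, `625·(L⁴)^{k−j}·ℓg⁵ ≤ cQa·ω^{k−j}`, `625·(L⁴)^{k−j}·gain ≤ cQb·ω^{k−j}` are displayed;
every other binder is the END's, verbatim at the data of record.  Conclusion LITERALLY the END's.
[cite: Balaban1987RG1, Thm 1 p.259, (1.18) p.263, (2.13)-(2.14) p.268, (3.53) p.280, (4.20)-(4.22) pp.285-286; Balaban1988RG2Cluster, (1.23)-(1.29) pp.7-8, (1.33)-(1.36) p.9] -/
theorem termSize_ne9_and_fadingMemory_ofRecordSpecies [Nonempty ι] [NormedAddCommGroup E] [NormedSpace ℂ E]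
    (G : ClusterGeom (doubleCarriers R.carriers)) (U₁ : Bg) (pt : Bg → E) (𝔭 : SpeciesParams R Bg E ι Pt)
    {ℓg gain : ℕ → ℕ → ℝ} (ℓk : ℕ → ℕ → ℝ) {cdir cK δ₀ δ₁ w w0 c0 c1 cQa cQb : ℝ} {W : Set (ℕ → ℝ)}
    {Adm MF : Bg → Set (E → (doubleCarriers R.carriers).Dom → ℝ)}
    {r : Bg → ℕ → (E → (doubleCarriers R.carriers).Dom → ℝ) → ℝ} {A : Bg → E → (doubleCarriers R.carriers).Dom → ℝ}
    {act : Bg → ℕ → ℝ → E → lp (fun _ : ι => ℂ) ∞ → G.P → ℂ}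
    {n : Bg → ℕ → ℝ → E → G.P → ℝ} {lip clip : ℕ → ℝ} {a d : G.P → ℝ} {δv : (doubleCarriers R.carriers).Dom → ℝ}
    {κ B lipbar clipbar qTbar ω cr aA Nbar clipa lam : ℝ} {p₀ N : ℕ → ℝ}
    -- species (a): the analytic clauses of `CurData.Admissible` at the data of record, and the letters
    (hκ₁1 : 1 ≤ 𝔭.κ₁) (hrT : ∀ k, 0 < 𝔭.rT k) (hRad : ∀ X, 0 < 𝔭.Rad X)
    (hcur : ∀ (U : Bg) (k : ℕ) (s : ℕ → ℝ) (y : ι) (a : SCube R) (b : Finset (SCube R)) (x : (doubleCarriers R.carriers).Dom),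
      ∀ t ∈ sphere (0:ℂ) (𝔭.rT k), ∀ (s' : SCube R → ℝ) (σ' : SCube R → ℂ), OnContour 𝔭.κ₁ (cubesList R k a b) s' σ' →
        DifferentiableOn ℂ (𝔭.cur U k s y a b x t s' σ') (ball 0 (𝔭.ϱ U k s y a b x)) ∧
          MapsTo (𝔭.cur U k s y a b x t s' σ') (ball 0 (𝔭.ϱ U k s y a b x)) (ball 0 (𝔭.Rad x.1)))
    (hϱgt : ∀ U k s y a b x, 1 < 𝔭.ϱ U k s y a b x)
    (hϱinv : ∀ (U : Bg) (k : ℕ) (s : ℕ → ℝ) (y : ι), ∀ a ∈ boxes R k (𝔭.Yout k y), ∀ b ∈ families R k (𝔭.Yout k y) a,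
      ∀ (j : ℕ), ∀ x ∈ sources R k a j, (𝔭.ϱ U k s y a b x)⁻¹ ≤ cdir * ℓg k j)
    (hℓ : ∀ k j, 0 < ℓg k j) (hκ : 144 ≤ κ) (hκ₁ : 69 ≤ 𝔭.κ₁)
    (hLaℓ : ∀ k j, j ≤ k → 625 * ((R.F.L : ℝ) ^ 4) ^ (k - j) * ℓg k j ^ 5 ≤ cQa * agePow ω k j)
    (hAa : ∀ U, PieceAdditiveOn (analyticClass (𝔭.D U).R) (𝔭.D U).toC)
    (hclipa : 0 ≤ clipa) (hcdir : 0 < cdir) (hhalf : ∀ k j, cdir * ℓg k j < 1 / 2)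
    (hcont : ∀ U, ∀ (k : ℕ) (s : ℕ → ℝ) (y : ι) (a : SCube R) (b : Finset (SCube R)) (x : (doubleCarriers R.carriers).Dom),
      ContinuousOn (fun q : (ℂ × ((SCube R → ℝ) × (SCube R → ℂ))) × ℂ => (𝔭.D U).cur k s y a b x q.1.1 q.1.2.1 q.1.2.2 q.2)
        ((sphere (0:ℂ) ((𝔭.D U).r k) ×ˢ {q | OnContour (𝔭.D U).κ₁ ((𝔭.D U).cubes k y a b) q.1 q.2}) ×ˢ sphere (0:ℂ) 1))
    (hlip : ∀ U, ∀ g ∈ W, ∀ g' ∈ W, ∀ (k : ℕ) (y : ι), ∀ a ∈ (𝔭.D U).S0 k y, ∀ b ∈ (𝔭.D U).SY k y a, ∀ (j : ℕ),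
      ∀ x ∈ (𝔭.D U).src k y a j, ∀ t ∈ sphere (0:ℂ) ((𝔭.D U).r k), ∀ (s' : SCube R → ℝ) (σ' : SCube R → ℂ),
        OnContour (𝔭.D U).κ₁ ((𝔭.D U).cubes k y a b) s' σ' → ∀ τ ∈ ball (0:ℂ) (1 / (2 * (cdir * ℓg k j))),
          ‖(𝔭.D U).cur k g y a b x t s' σ' τ - (𝔭.D U).cur k g' y a b x t s' σ' τ‖ ≤ clipa * ((𝔭.D U).R x.1 / 2) * |g k - g' k|)
    (hroom : ∀ U, ∀ g ∈ W, ∀ (k : ℕ) (y : ι), ∀ a ∈ (𝔭.D U).S0 k y, ∀ b ∈ (𝔭.D U).SY k y a, ∀ (j : ℕ), ∀ x ∈ (𝔭.D U).src k y a j,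
      ∀ t ∈ sphere (0:ℂ) ((𝔭.D U).r k), ∀ (s' : SCube R → ℝ) (σ' : SCube R → ℂ), OnContour (𝔭.D U).κ₁ ((𝔭.D U).cubes k y a b) s' σ' →
        ∀ τ ∈ ball (0:ℂ) (1 / (2 * (cdir * ℓg k j))), ‖(𝔭.D U).cur k g y a b x t s' σ' τ‖ ≤ (𝔭.D U).R x.1 / 2)
    -- species (b): the analytic ∕ geometric clauses of `KerData.Admissible` at the data of record, and the letters
    (hzero : ∀ U k s y a b x t s' σ' p q, 𝔭.ker U k s y a b x t s' σ' p q (0 : E → ℂ) = 0)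
    (hkerB : ∀ (U : Bg) (k : ℕ) (s : ℕ → ℝ) (y : ι), ∀ a ∈ boxes R k (𝔭.Yout k y), ∀ b ∈ families R k (𝔭.Yout k y) a, ∀ (j : ℕ),
      ∀ x ∈ sources R k a j, ∀ t ∈ sphere (0:ℂ) (𝔭.rT k), ∀ (s' : SCube R → ℝ) (σ' : SCube R → ℂ),
        OnContour 𝔭.κ₁ (cubesList R k a b) s' σ' → ∀ p ∈ 𝔭.pts k y a, ∀ q ∈ 𝔭.pts k y a, ∀ (F : E → ℂ) (M : ℝ),
          DifferentiableOn ℂ F (ball 0 (𝔭.Rad x.1)) → (∀ z ∈ ball (0:E) (𝔭.Rad x.1), ‖F z‖ ≤ M) →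
            ‖𝔭.ker U k s y a b x t s' σ' p q F‖ ≤
              cK * M * gain k j * 𝔭.ρd p q ^ 𝔭.m * Real.exp (-(δ₀ * (𝔭.dX x.1 p + 𝔭.dX x.1 q))))
    (hgeom : ∀ (k : ℕ) (y : ι) (a : SCube R) (x : (doubleCarriers R.carriers).Dom), ∀ p ∈ 𝔭.pts k y a, ∀ q ∈ 𝔭.pts k y a,
      δ₁ * 𝔭.ρd (𝔭.p0 x.1) p + δ₁ * 𝔭.ρd p q ≤ δ₀ * (𝔭.dX x.1 p + 𝔭.dX x.1 q) + w * R.carriers.d x.1 + w0)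
    (hsum0 : ∀ (k : ℕ) (y : ι) (a : SCube R) (X : R.carriers.Dom), ∑ p ∈ 𝔭.pts k y a, Real.exp (-(δ₁ * 𝔭.ρd (𝔭.p0 X) p)) ≤ c0)
    (hsum1 : ∀ (k : ℕ) (y : ι) (a : SCube R), ∀ p ∈ 𝔭.pts k y a,
      ∑ q ∈ 𝔭.pts k y a, 𝔭.ρd p q ^ 𝔭.m * Real.exp (-(δ₁ * 𝔭.ρd p q)) ≤ c1)
    (hcK : 0 ≤ cK) (hgain : ∀ k j, 0 ≤ gain k j) (hρd : ∀ p q, 0 ≤ 𝔭.ρd p q) (hc0 : 0 ≤ c0) (hc1 : 0 ≤ c1)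
    (hκw : 144 ≤ κ - w) (hLbℓ : ∀ k j, j ≤ k → 625 * ((R.F.L : ℝ) ^ 4) ^ (k - j) * gain k j ≤ cQb * agePow ω k j)
    (hAb : ∀ U, PieceAdditiveOn (analyticClass (𝔭.K U).R) (𝔭.K U).toC) (hlam : 0 ≤ lam)
    (hkerC : ∀ U, ∀ (k : ℕ) (s : ℕ → ℝ) (y : ι) (a : SCube R) (b : Finset (SCube R)) (x : (doubleCarriers R.carriers).Dom),
      ∀ p ∈ (𝔭.K U).pts k y a, ∀ q ∈ (𝔭.K U).pts k y a, ∀ F : E → ℂ, DifferentiableOn ℂ F (ball 0 ((𝔭.K U).R x.1)) →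
        Continuous fun wv : ℂ × (SCube R → ℝ) × (SCube R → ℂ) => (𝔭.K U).ker k s y a b x wv.1 wv.2.1 wv.2.2 p q F)
    (hkerL : ∀ U, ∀ g ∈ W, ∀ g' ∈ W, ∀ (k : ℕ) (y : ι), ∀ a ∈ (𝔭.K U).S0 k y, ∀ b ∈ (𝔭.K U).SY k y a, ∀ (j : ℕ),
      ∀ x ∈ (𝔭.K U).src k y a j, ∀ t ∈ sphere (0:ℂ) ((𝔭.K U).r k), ∀ (s' : SCube R → ℝ) (σ' : SCube R → ℂ),
        OnContour (𝔭.K U).κ₁ ((𝔭.K U).cubes k y a b) s' σ' → ∀ p ∈ (𝔭.K U).pts k y a, ∀ q ∈ (𝔭.K U).pts k y a,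
          ∀ (F : E → ℂ) (M : ℝ), DifferentiableOn ℂ F (ball 0 ((𝔭.K U).R x.1)) → (∀ z ∈ ball (0:E) ((𝔭.K U).R x.1), ‖F z‖ ≤ M) →
            ‖(𝔭.K U).ker k g y a b x t s' σ' p q F - (𝔭.K U).ker k g' y a b x t s' σ' p q F‖ ≤
              cK * lam * M * gain k j * (𝔭.K U).ρd p q ^ (𝔭.K U).m * Real.exp (-(δ₀ * ((𝔭.K U).dX x.1 p + (𝔭.K U).dX x.1 q))) *
                |g k - g' k|)
    (hcQa : 0 ≤ cQa) (hcQb : 0 ≤ cQb) (hMF : ∀ U, MF U ⊆ analyticClass (𝔭.D U).R)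
    -- the recursion data, per chart
    (U₀ : Bg → E) (explZ : Bg → ℕ → E → (doubleCarriers R.carriers).Dom → ℝ) (base : Bg → E → (doubleCarriers R.carriers).Dom → ℝ)
    (hAdm : ∀ U, AdmissibleTerms (EfOf G (act U) (weightOf (𝔭.D U).toC.frame (𝔭.D U).κ₁ 21203 (2 * (2 ^ 20 + 1)) ((𝔭.D U).Kp cdir + (𝔭.K U).Kp cK w0 c0 c1))
      (U₀ U) (explZ U) (base U) (cpieceChannel (𝔭.D U).toC + cpieceChannel (𝔭.K U).toC) (margProj (r U) (A U))) W (Adm U))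
    (hres : ∀ U, AdmRestrict (Adm U))
    (hrA : ∀ U, ReadAdditive (Adm U) (r U)) (hr0 : ∀ U, ReadZero (r U)) (hrs : ∀ U, ReadSize (Adm U) (r U) κ cr)
    (hA : ∀ U, DirSize (A U) κ aA) (hcr : 0 ≤ cr) (haA : 0 ≤ aA) (hPinto : ∀ U, ProjInto (Adm U) (MF U) (margProj (r U) (A U)))
    (hclip0 : ∀ k, 0 ≤ clip k)
    (hCup : ∀ U, ∀ g ∈ W, ∀ g' ∈ W, ∀ (k : ℕ) (V : E) (X : (doubleCarriers R.carriers).Dom), (doubleCarriers R.carriers).scale X = k + 1 →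
      ∀ Q ∈ admOf G (act U) (weightOf (𝔭.D U).toC.frame (𝔭.D U).κ₁ 21203 (2 * (2 ^ 20 + 1)) ((𝔭.D U).Kp cdir + (𝔭.K U).Kp cK w0 c0 c1)) (U₀ U) (explZ U)
        (base U) (cpieceChannel (𝔭.D U).toC + cpieceChannel (𝔭.K U).toC) (margProj (r U) (A U)) W
        (fun k => sizeRadius (fun k j => (1 + cr * aA) * (tauOfG cQa (agePow ω) + tauOfG cQb (agePow ω)) k j) N k) k,
      ∀ γ' ∈ G.vol X,
        ‖act U k (g k) V Q γ'‖ ≤ n U k (g' k) V γ' ∧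
          ‖act U k (g k) V Q γ' - act U k (g' k) V Q γ'‖ ≤ clip k * |g k - g' k| * n U k (g' k) V γ')
    (hclipb : ∀ k, clip k ≤ clipbar) (hNb : ∀ j, N j ≤ Nbar)
    (hqTb : (64 * clipa * cQa + lam * cQb) * ((1 + cr * aA) * Nbar) * (1 - ω)⁻¹ ≤ qTbar)
    (hKP : ∀ U, TwoPointKP G W (act U) (admOf G (act U) (weightOf (𝔭.D U).toC.frame (𝔭.D U).κ₁ 21203 (2 * (2 ^ 20 + 1)) ((𝔭.D U).Kp cdir + (𝔭.K U).Kp cK w0 c0 c1))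
      (U₀ U) (explZ U) (base U) (cpieceChannel (𝔭.D U).toC + cpieceChannel (𝔭.K U).toC) (margProj (r U) (A U)) W
      (fun k => sizeRadius (fun k j => (1 + cr * aA) * (tauOfG cQa (agePow ω) + tauOfG cQb (agePow ω)) k j) N k)) (n U) lip a d)
    (hdec : G.DecayExtract δv d) (hpin : G.PinBudget a δv (fun _ => B) κ)
    (hexplZ : ∀ U, ∀ (k : ℕ) (V : E) (X : (doubleCarriers R.carriers).Dom), (doubleCarriers R.carriers).scale X = k + 1 →
      |explZ U k V X| ≤ Real.exp (-(κ * (doubleCarriers R.carriers).d X)) * p₀ k)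
    (hbase0 : ∀ U, ∀ (V : E) (X : (doubleCarriers R.carriers).Dom), (doubleCarriers R.carriers).scale X = 0 →
      |base U V X| ≤ Real.exp (-(κ * (doubleCarriers R.carriers).d X)) * N 0)
    (hNsucc : ∀ j, p₀ j + 2 * B ≤ N (j + 1)) (hNnn : ∀ j, 0 ≤ N j)
    (hB : 0 ≤ B) (hlipb : ∀ k, lip k ≤ lipbar) (hω : 0 ≤ ω) (hω1 : ω < 1)
    (hpos : 0 < ω + 8 * lipbar * B * ((1 + cr * aA) * (cQa + cQb))) :
    TermSize (EreOf G act (fun U => weightOf (𝔭.D U).toC.frame (𝔭.D U).κ₁ 21203 (2 * (2 ^ 20 + 1)) ((𝔭.D U).Kp cdir + (𝔭.K U).Kp cK w0 c0 c1)) U₀ explZ base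
        (fun U => cpieceChannel (𝔭.D U).toC + cpieceChannel (𝔭.K U).toC) (fun U => margProj (r U) (A U)) pt) W κ N ∧
      NE9 (EreOf G act (fun U => weightOf (𝔭.D U).toC.frame (𝔭.D U).κ₁ 21203 (2 * (2 ^ 20 + 1)) ((𝔭.D U).Kp cdir + (𝔭.K U).Kp cK w0 c0 c1)) U₀ explZ base
        (fun U => cpieceChannel (𝔭.D U).toC + cpieceChannel (𝔭.K U).toC) (fun U => margProj (r U) (A U)) pt) W κ
        (prodModuli (8 * clipbar * B + 8 * lipbar * B * qTbar) fun _ => ω + 8 * lipbar * B * ((1 + cr * aA) * (cQa + cQb))) ∧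
        FadingMemory ((8 * clipbar * B + 8 * lipbar * B * qTbar) / (ω + 8 * lipbar * B * ((1 + cr * aA) * (cQa + cQb))))
          (ω + 8 * lipbar * B * ((1 + cr * aA) * (cQa + cQb)))
          (prodModuli (8 * clipbar * B + 8 * lipbar * B * qTbar)
            fun _ => ω + 8 * lipbar * B * ((1 + cr * aA) * (cQa + cQb))) :=
  termSize_ne9_and_fadingMemory_realRow G U₁ pt (D := fun U => 𝔭.D U) (K := fun U => 𝔭.K U)
    (fun U => admissible_curDataOfRecord R 𝔭.Yout 𝔭.κ₁ 𝔭.rT 𝔭.Rad (𝔭.cur U) (𝔭.ϱ U) hκ₁1 hrT hRad (hcur U) (hϱgt U) (hϱinv U)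
      hcdir.le)
    hℓ
    (fun U => levelCountsG_of_frameOfRecord_gain R (𝔭.D U).toC.frame 𝔭.Yout (fun _ _ => rfl) (fun _ _ _ => rfl)
      (fun _ _ _ _ => rfl) (fun _ _ _ _ => rfl) (fun _ _ _ _ _ => rfl) (fun k _ a b _ => length_cubesList R k a b)
      (fun _ _ => le_rfl) hκ hκ₁ (fun k j => pow_nonneg (hℓ k j).le 5)
      (fun k j => mul_nonneg hcQa (agePow_nonneg hω k j)) hLaℓ)
    hAa hclipa hcdir hhalf hcont hlip hroom
    (fun U => admissible_kerDataOfRecord R 𝔭.Yout 𝔭.κ₁ 𝔭.rT 𝔭.Rad 𝔭.pts 𝔭.p0 𝔭.dX 𝔭.ρd 𝔭.m (𝔭.ker U) (ℓ := ℓk) hκ₁1 hrT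
      hRad (hzero U) (hkerB U) hgeom hsum0 hsum1 hcK hgain hρd hc0 hc1)
    (fun U => kappa1_eq R 𝔭.Yout 𝔭.κ₁ 𝔭.rT 𝔭.Rad 𝔭.pts 𝔭.p0 𝔭.dX 𝔭.ρd 𝔭.m (𝔭.ker U) (𝔭.cur U) (𝔭.ϱ U))
    (fun U => radius_eq R 𝔭.Yout 𝔭.κ₁ 𝔭.rT 𝔭.Rad 𝔭.pts 𝔭.p0 𝔭.dX 𝔭.ρd 𝔭.m (𝔭.ker U) (𝔭.cur U) (𝔭.ϱ U))
    (fun U => frame_dY_eq R 𝔭.Yout 𝔭.κ₁ 𝔭.rT 𝔭.Rad 𝔭.pts 𝔭.p0 𝔭.dX 𝔭.ρd 𝔭.m (𝔭.ker U) (𝔭.cur U) (𝔭.ϱ U))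
    (fun U => levelCountsG_kerDataOfRecord R 𝔭.Yout 𝔭.κ₁ 𝔭.rT 𝔭.Rad 𝔭.pts 𝔭.p0 𝔭.dX 𝔭.ρd 𝔭.m (𝔭.ker U) hκw hκ₁ hgain
      (fun k j => mul_nonneg hcQb (agePow_nonneg hω k j)) hLbℓ)
    hAb hlam hkerC hkerL (by norm_num) hcQa hcQb hMF U₀ explZ base hAdm hres hrA hr0 hrs hA hcr haA hPinto hclip0 hCup hclipb
    hNb hqTb hKP hdec hpin (𝔭.weightOf_record_pos hcdir hrT hcK hc0 hc1) hexplZ hbase0 hNsucc hNnn hB hlipb hω hω1 hpos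

end Summit.QuantumFields.BalabanUV.T4Continuum.NE9EndOfRecordSpecies

end
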